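import Mathlib
import HarnessLib

/-!
# `ContinuumLegGivenGap` (stmt-QuantumFields-15828), line `Sketch` (reshape 17-RP) — the log-convex chord bound

Support file for the crux item stmt-QuantumFields-15828, stub `stub_rpCore` (the reflection-positivity core):
the elementary real-analysis step. A non-negative finite sequence `g 0, …, g N` which is LOG-CONVEX
(`g n ^ 2 ≤ g (n-1) * g (n+1)` at every interior index) lies below the geometric chord through its end values:
with `g 0 ≤ B` (`B ≥ 1`) and `g N ≤ D e^{-μ N}` (`D ≥ 1`) one has `g n ≤ B · e^{-μ n + (log D / N) n}` for all
`n ≤ N`. (If some value vanishes, log-convexity forces every interior value to vanish; otherwise take logarithms: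
the increments of `log g` are non-decreasing, so the mean of the first `n` increments is at most the mean of all
`N`.) Used with `g n = corr_{β,2S+1}(F∘Θ, F; n)`, `N = S`, `B = 2‖F‖∞²`, `D =` the clustering constant of the
hypothesis: the β-dependence of `D` only enters through `log D / N`, i.e. through a volume threshold.

No definitions; Mathlib only. [folklore]
-/

namespace Summit.QuantumFields.YangMills.Theorems.ContinuumLegGivenGap

open Finset

/-- **Means of initial segments of a non-decreasing sequence**: if `Δ` is non-decreasing on the indices `< N`,
then `N · ∑_{i<n} Δ i ≤ n · ∑_{i<N} Δ i` for every `n ≤ N`. [folklore] -/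
theorem rpCore_initial_mean_le (Δ : ℕ → ℝ) (N : ℕ) (hΔ : ∀ i j : ℕ, i ≤ j → j < N → Δ i ≤ Δ j) :
    ∀ n : ℕ, n ≤ N → (N : ℝ) * ∑ i ∈ range n, Δ i ≤ (n : ℝ) * ∑ i ∈ range N, Δ i := by
  induction N with
  | zero =>
    intro n hn
    obtain rfl : n = 0 := Nat.le_zero.1 hn
    simp
  | succ N ih =>
    intro n hn
    rcases Nat.lt_or_ge n (N + 1) with hlt | hge
    · have hnN : n ≤ N := Nat.lt_succ_iff.1 hlt
      have h1 := ih (fun i j hij hj => hΔ i j hij (hj.trans (Nat.lt_succ_self N))) n hnN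
      -- `∑_{i<n} Δ i ≤ n Δ N`
      have h2 : ∑ i ∈ range n, Δ i ≤ (n : ℝ) * Δ N := by
        have h3 : ∀ i ∈ range n, Δ i ≤ Δ N := fun i hi =>
          hΔ i N ((mem_range.1 hi).le.trans hnN) (Nat.lt_succ_self N)
        calc ∑ i ∈ range n, Δ i ≤ ∑ _i ∈ range n, Δ N := sum_le_sum h3
          _ = (n : ℝ) * Δ N := by rw [sum_const, card_range, nsmul_eq_mul]
      rw [sum_range_succ]
      push_cast
      nlinarith [h1, h2]
    · have heq : n = N + 1 := le_antisymm hn hge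
      subst heq
      push_cast
      exact le_rfl

/-- **Zeros of a log-convex non-negative sequence propagate to every interior index.** [folklore] -/
theorem rpCore_interior_eq_zero (g : ℕ → ℝ) (N : ℕ)
    (hlc : ∀ n : ℕ, 1 ≤ n → n + 1 ≤ N → g n ^ 2 ≤ g (n - 1) * g (n + 1))
    {m : ℕ} (hm : m ≤ N) (hgm : g m = 0) :
    ∀ n : ℕ, 1 ≤ n → n + 1 ≤ N → g n = 0 := by
  -- squares bounded by zero vanish
  have sq0 : ∀ n : ℕ, 1 ≤ n → n + 1 ≤ N → g (n - 1) * g (n + 1) = 0 → g n = 0 := by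
    intro n h1 h2 h0
    have h := hlc n h1 h2
    rw [h0] at h
    exact pow_eq_zero_iff (n := 2) (by norm_num) |>.1 (le_antisymm h (sq_nonneg _)) |> fun h' => h'
  -- upward from `m`
  have up : ∀ d n : ℕ, n = m + d → 1 ≤ n → n + 1 ≤ N → g n = 0 := by
    intro d
    induction d with
    | zero => intro n hn _ _; rw [hn, Nat.add_zero]; exact hgm
    | succ d ih =>
      intro n hn h1 h2
      refine sq0 n h1 h2 ?_
      have hprev : g (n - 1) = 0 := by
        rcases Nat.eq_zero_or_pos (m + d) with h0 | hposmd
        · have hm0 : m = 0 := by omega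
          have : n - 1 = m := by omega
          rw [this, hgm]
        · exact ih (n - 1) (by omega) (by omega) (by omega)
      rw [hprev, zero_mul]
  -- downward from `m`
  have down : ∀ d n : ℕ, m = n + d → 1 ≤ n → n + 1 ≤ N → g n = 0 := by
    intro d
    induction d with
    | zero => intro n hn _ _; rw [← Nat.add_zero n, ← hn]; exact hgm
    | succ d ih =>
      intro n hn h1 h2
      refine sq0 n h1 h2 ?_
      have hnext : g (n + 1) = 0 := by
        rcases Nat.lt_or_ge (n + 1 + 1) (N + 1) with hlt | hge
        · exact ih (n + 1) (by omega) (by omega) (by omega)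
        · -- `n + 1 = N = m`
          have : n + 1 = m := by omega
          rw [this, hgm]
      rw [hnext, mul_zero]
  intro n h1 h2
  rcases le_total m n with hmn | hnm
  · exact up (n - m) n (by omega) h1 h2
  · exact down (m - n) n (by omega) h1 h2

/-- **The log-convex chord bound.** A non-negative sequence on `0, …, N` (`N > 0`) which is log-convex at every
interior index, with `g 0 ≤ B` (`B ≥ 1`) and `g N ≤ D e^{-μ N}` (`D ≥ 1`), satisfies
`g n ≤ B e^{-μ n + (log D / N) n}` for all `n ≤ N`. [folklore] -/
theorem rpCore_chordBound :
    ∀ (g : ℕ → ℝ) (N : ℕ) (B D μ : ℝ), 0 < N → 1 ≤ B → 1 ≤ D →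
      (∀ n : ℕ, n ≤ N → 0 ≤ g n) →
      (∀ n : ℕ, 1 ≤ n → n + 1 ≤ N → g n ^ 2 ≤ g (n - 1) * g (n + 1)) →
      g 0 ≤ B → g N ≤ D * Real.exp (-(μ * N)) →
      ∀ n : ℕ, n ≤ N → g n ≤ B * Real.exp (-(μ * n) + Real.log D / N * n) := by
  intro g N B D μ hN hB hD hpos hlc h0 hNb
  have hB0 : 0 < B := lt_of_lt_of_le one_pos hB
  have hD0 : 0 < D := lt_of_lt_of_le one_pos hD
  have hlogB : 0 ≤ Real.log B := Real.log_nonneg hB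
  have hlogD : 0 ≤ Real.log D := Real.log_nonneg hD
  have hNr : (0 : ℝ) < N := by exact_mod_cast hN
  intro n hn
  -- the end points
  have hend0 : g 0 ≤ B * Real.exp (-(μ * (0 : ℕ)) + Real.log D / N * (0 : ℕ)) := by
    simpa using h0
  have hendN : g N ≤ B * Real.exp (-(μ * N) + Real.log D / N * N) := by
    have h1 : Real.log D / N * N = Real.log D := div_mul_cancel₀ _ hNr.ne'
    rw [h1, Real.exp_add, Real.exp_log hD0]
    calc g N ≤ D * Real.exp (-(μ * N)) := hNb
      _ = 1 * (Real.exp (-(μ * N)) * D) := by ring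
      _ ≤ B * (Real.exp (-(μ * N)) * D) := by gcongr
  by_cases hz : ∃ m : ℕ, m ≤ N ∧ g m = 0
  · -- some value vanishes: all interior values vanish
    obtain ⟨m, hm, hgm⟩ := hz
    rcases Nat.eq_zero_or_pos n with rfl | hn1
    · exact hend0
    rcases eq_or_lt_of_le hn with rfl | hlt
    · exact hendN
    rw [rpCore_interior_eq_zero g N hlc hm hgm n hn1 (by omega)]
    positivity
  · -- all values positive: logarithms
    push Not at hz
    have hgpos : ∀ m : ℕ, m ≤ N → 0 < g m := fun m hm => lt_of_le_of_ne (hpos m hm) (Ne.symm (hz m hm))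
    set φ : ℕ → ℝ := fun m => Real.log (g m) with hφ
    -- increments are non-decreasing
    set Δ : ℕ → ℝ := fun i => φ (i + 1) - φ i with hΔ
    have hconv : ∀ k : ℕ, 1 ≤ k → k + 1 ≤ N → 2 * φ k ≤ φ (k - 1) + φ (k + 1) := by
      intro k hk1 hk2
      have h := hlc k hk1 hk2
      have hl := Real.log_le_log (pow_pos (hgpos k (by omega)) 2) h
      rw [Real.log_pow, Real.log_mul (hgpos (k - 1) (by omega)).ne' (hgpos (k + 1) hk2).ne'] at hl
      simpa [hφ] using hl
    have hmono : ∀ i j : ℕ, i ≤ j → j < N → Δ i ≤ Δ j := by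
      intro i j hij hj
      induction j with
      | zero =>
        obtain rfl : i = 0 := Nat.le_zero.1 hij
        exact le_rfl
      | succ j ih =>
        rcases Nat.lt_or_ge i (j + 1) with hlt | hge
        · have h1 : Δ i ≤ Δ j := ih (Nat.lt_succ_iff.1 hlt) (by omega)
          have h2 : Δ j ≤ Δ (j + 1) := by
            have h := hconv (j + 1) (by omega) (by omega)
            simp only [hΔ]
            simp only [Nat.add_sub_cancel] at h
            linarith
          exact h1.trans h2
        · have : i = j + 1 := le_antisymm hij hge
          rw [this]
    have hmean := rpCore_initial_mean_le Δ N hmono n hn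
    have htel : ∀ k : ℕ, ∑ i ∈ range k, Δ i = φ k - φ 0 := by
      intro k
      simp only [hΔ]
      exact sum_range_sub φ k
    rw [htel n, htel N] at hmean
    -- `φ n ≤ φ 0 + (n/N) (φ N - φ 0)`, end values
    have hφ0 : φ 0 ≤ Real.log B := Real.log_le_log (hgpos 0 (Nat.zero_le _)) h0
    have hφN : φ N ≤ Real.log D - μ * N := by
      have h := Real.log_le_log (hgpos N le_rfl) hNb
      rw [Real.log_mul hD0.ne' (Real.exp_pos _).ne', Real.log_exp] at h
      linarith
    have hnr : (0 : ℝ) ≤ n := Nat.cast_nonneg n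
    have hnN : (n : ℝ) ≤ N := by exact_mod_cast hn
    -- assemble in the logarithm
    have hkey : φ n ≤ Real.log B + (-(μ * n) + Real.log D / N * n) := by
      -- N φ n ≤ (N - n) φ 0 + n φ N
      have h1 : (N : ℝ) * φ n ≤ ((N : ℝ) - n) * φ 0 + n * φ N := by nlinarith [hmean]
      have h2 : ((N : ℝ) - n) * φ 0 ≤ ((N : ℝ) - n) * Real.log B :=
        mul_le_mul_of_nonneg_left hφ0 (by linarith)
      have h3 : (n : ℝ) * φ N ≤ n * (Real.log D - μ * N) := mul_le_mul_of_nonneg_left hφN hnr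
      have h4 : ((N : ℝ) - n) * Real.log B ≤ N * Real.log B := by nlinarith
      have h5 : (N : ℝ) * φ n ≤ N * (Real.log B + (-(μ * n) + Real.log D / N * n)) := by
        have h6 : (N : ℝ) * (Real.log B + (-(μ * n) + Real.log D / N * n)) =
            N * Real.log B + n * (Real.log D - μ * N) := by
          field_simp
          ring
        rw [h6]
        linarith
      exact le_of_mul_le_mul_left h5 hNr
    calc g n = Real.exp (φ n) := (Real.exp_log (hgpos n hn)).symm
      _ ≤ Real.exp (Real.log B + (-(μ * n) + Real.log D / N * n)) := Real.exp_le_exp.2 hkey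
      _ = B * Real.exp (-(μ * n) + Real.log D / N * n) := by rw [Real.exp_add, Real.exp_log hB0]

end Summit.QuantumFields.YangMills.Theorems.ContinuumLegGivenGap
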